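import Mathlib
import HarnessLib
import HarnessLib.Audit
import Summits.AnomalousDissipation.Statement
import Literature.Analysis.FluidPDE.ZerothLaw

/-!
Route: InterimFluidKinetic

CLOSED (superseded) 2026-08-15T10:38:54Z by planner-AnomalousDissipation-route-AnomalousDissipation-InterimFluidKinetic-0 — reason: superseded:route-AnomalousDissipation-Neg — superseded by route-AnomalousDissipation-Neg — note: superseded by route-AnomalousDissipation-Neg: legacy interim carry-over, UNDER FLOOR (0 cruxes), no Target/Assembly/mechanism; its only load-bearing content, the (→) half of item 0011 ZerothLawNeg ↔ ¬ZerothLaw, IS Neg.Assembly (stmt-AnomalousDissipation-0229); 0012 (ZerothLaw → S03) is used by no ro. The file is kept as the record of this route; refuted decls are indexed as negative knowledge (`ledger negatives`).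

Carry-over of the interim blast's sorried statements ABOUT AnomalousDissipation from interim group
G12 FluidKinetic (Statements/Turb/ZerothLaw.lean; harness21 @ d8f2665). Thesis (to be sharpened by
the route planner, D-0014e): the equivalences/implications these 2 statements assert
(zerothLawNeg_iff_not_zerothLaw, zerothLawTimePeriodic) hold and, combined, bear on
AnomalousDissipation. They enter as UNSTAMPED statement items: grounder first (most are cited
results -> named facts in Literature), then refuter, then provers.

UNDER FLOOR: fewer than 2 cruxes remain after retriage (legacy route; D-0019).

Rationale: M5 migration (docs/m5/PLAN.md 2c‴ as amended by D-0014b): no workspace, no THESIS.md; the interim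
decl text is in run/m5/workspaces/ for the operator and quoted in each item's --informal.

Novelty: Nearest prior art (searched: `lit search --hybrid "zeroth law of turbulence anomalous dissipation
equivalent formulation liminf subsequence vanishing viscosity"`, `lit search "anomalous dissipation
forced Navier-Stokes time-periodic force vanishing viscosity steady force" --source all`, `lit
frontier AnomalousDissipation --since 2020`, `lit read` of both hits): BrueDeLellis2023
(arXiv:2207.06301) p.3 eq. (1.2) states the zeroth law in liminf form and p.4 Thm 1.1 in sequence
form `nu_m -> 0`; item ZerothLawNegIffNotZerothLaw is exactly the bookkeeping that the `∃ ε>0 ∀ j`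
form of Literature.Turb.ZerothLaw and the `Tendsto … (𝓝 0)` dual
Literature.Analysis.FluidPDE.ZerothLawNeg are complementary (nonnegativity
Literature.Analysis.FluidPDE.meanDissipation_nonneg + subsequence stability of the admissible
class). Ibid. p.5 Questions 1–2 pose the ν-independent and the time-independent force as the HARDER
directions, and Cheskidov2023 (arXiv:2311.04182 = paper:arxiv-2311.04182) p.4–5, Thm 1.3 works with
ν-dependent time-periodic forces; item ZerothLawTimePeriodicStmt is the trivial converse embedding
steady ⇒ time-periodic (a steady force is τ-periodic for every τ). Delta: NONE claimed — this is an
interim carry-over (M5 migration of Statements/Turb/ZerothLaw.lean, group G12) recording two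
folklore facts about the summit statement and its variants turb.S02/S03; it imports no mechanism
toward Summit.AnomalousDissipation and has no Assembly or Target. Expected grade: known.  [refs: 2207.06301, 2311.04182, paper:arxiv-2311.04182, BrueDeLellis2023, Cheskidov2023]

Barriers (technique_class: elementary-logic statement-reformulation): None of the 12 catalogued entries under Literature/Barriers/AnomalousDissipation applies, because
this route carries no bet on the summit: item 1 is the logical equivalence dual ↔ ¬summit (true
whichever side holds), item 2 the implication steady ⇒ time-periodic; neither a witness for
Literature.Turb.ZerothLaw nor a proof of Literature.Analysis.FluidPDE.ZerothLawNeg nor a refutation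
of Literature.Analysis.FluidPDE.ZerothLawTimePeriodic is attempted. In particular
Literature.Barriers.AnomalousDissipation.Cheskidov2023_thm13_not_forceRobustNoAnomaly (energy-method
/ force-robust proofs of ZerothLawNeg are refuted by Cheskidov2023 Thm 1.3) is not met: it blocks
force-robust arguments FOR the dual, and itself cites Literature.Turb.zerothLawNeg_iff_not_zerothLaw
(= item 1) only as the dictionary between ¬ZerothLaw and ZerothLawNeg; and the witness-side barriers
(e.g. Literature.Barriers.AnomalousDissipation.BrueDeLellis2023_noAnomaly_beforeEulerSingularity: no
anomaly below the classical Euler lifespan, BrueDeLellis2023 App. Lemma 7) constrain constructions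
of ZerothLaw families, which this route does not undertake. Honest summary: "it does not need to
evade anything; there is no mechanism here" — technique class elementary-logic /
statement-reformulation shares no token with any catalogued class.

History (route lifecycle, newest last):
- 2026-08-15T10:38:54Z · CLOSED superseded — superseded:route-AnomalousDissipation-Neg (planner-AnomalousDissipation-route-AnomalousDissipation-Inte)

sub-problem: AnomalousDissipation · status: closed(superseded) · opened operator:999:2871195 2026-08-13T05:39:09Z · rev 2 · ledger route-AnomalousDissipation-InterimFluidKinetic
GENERATED by the gate from the ledger (D-0016/17). Provers cite these decls: `theorem foo : Summit.AnomalousDissipation.AnomalousDissipation.Theses.InterimFluidKinetic.<Decl> := …` in Summits/AnomalousDissipation/AnomalousDissipation/Theorems/<Name>.lean.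
-/

namespace Summit.AnomalousDissipation.AnomalousDissipation.Theses.InterimFluidKinetic

open scoped BigOperators Topology Manifold Classical MeasureTheory ProbabilityTheory Matrix InnerProductSpace ComplexConjugate ContinuousMap
open Filter Set Function TopologicalSpace MeasureTheory

attribute [summit_statement] _root_.AnomalousDissipation

open Literature.Turb Literature.Analysis.FluidPDE

/-- item stmt-AnomalousDissipation-0011 · support · rank 2 · closed · moot by None · by operator
why it might fail: It cannot as stated: (→) is 4 lines; (←) needs only meanDissipation ≥ 0 incl. junk values (LANDED: Literature.Analysis.FluidPDE.meanDissipation_nonneg) + subsequence extraction; hypotheses of ZerothLaw/ZerothLawNeg are syntactically identical, admissible class closed under subsequences.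
sources: BrueDeLellis2023 = paper:arxiv-2207.06301 p.3 eq. (1.2) (liminf form) and p.4 Thm 1.1 (sequence form nu_m -> 0): the two formulations the item reconciles, Literature.Analysis.FluidPDE.meanDissipation_nonneg (Literature/Analysis/FluidPDE/LongTimeAverageNonneg.lean:64) — the only non-logical ingredient, sorry-free (re-verified gen-2), Mathlib Filter.extraction_of_frequently_atTop (Mathlib/Order/Filter/AtTopBot/Basic.lean:114)
**turb.S02** (relation between the summit and its dual). `ZerothLawNeg` is not the *literal*
negation of `ZerothLaw` — the former asserts a limit `εⱼ → 0`, the latter a uniform lower bound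
`infⱼ εⱼ > 0` rather than `limsupⱼ εⱼ > 0` — but the two are equivalent: `ZerothLawNeg → ¬
ZerothLaw` is immediate, and conversely if `εⱼ ↛ 0` for some admissible family then, since `εⱼ ≥ 0`
(a `limsup` of nonnegative Cesàro means, junk value `0` included), some subsequence has `ε_{j_k} ≥ ε
> 0`, and subsequences of admissible families are admissible (`summits/turb-zeroth-neg`). [folklore]
[interim: Statements/Turb/ZerothLaw.lean:278 `zerothLawNeg_iff_not_zerothLaw`] -/
@[route_item "route-AnomalousDissipation-InterimFluidKinetic"]
def ZerothLawNegIffNotZerothLaw : Prop :=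
  ZerothLawNeg ↔ ¬ ZerothLaw

/-- item stmt-AnomalousDissipation-0012 · support · rank 3 · closed · moot by None · by operator
why it might fail: It cannot as stated: F := fun _ => f, τ := 1; Torus.stLift (fun _ => f) p = Torus.lift f p.2 by rfl, so IsSmoothSpaceTimeOn univ F from (hs.comp contDiff_snd).contDiffOn; all other conjuncts copied verbatim (ZerothLaw already forces by fun _ => f).
sources: grounder-ground-B-0 note 2026-08-13T06:46:52Z on this item: complete sorry-free proof script (rc 0) — rintro/refine + rfl rewrite of stLift + ContDiff.comp contDiff_snd, Literature/Analysis/FunctionSpaces/TorusCalculus.lean:75 Torus.stLift, :365 Torus.IsSmoothSpaceTimeOn; FlatTorus.lean:360 Torus.lift, :482 Torus.IsSmooth (definitions making the reduction rfl; re-read gen-2), BrueDeLellis2023 = paper:arxiv-2207.06301 p.5 Question 2 (time-INdependent force is the harder direction; steady ⇒ time-periodic is the trivial converse), Cheskidov2023 = paper:arxiv-2311.04182 p.4–5 Thm 1.3 (time-periodic, ν-dependent forces: context for turb.S03)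
The time-periodic zeroth law contains the steady one (a steady force is periodic of every period;
joint smoothness of `(t, x) ↦ f x` from `Torus.IsSmooth f`). [folklore]  [interim:
Statements/Turb/ZerothLaw.lean:299 `ZerothLaw.zerothLawTimePeriodic`] -/
@[route_item "route-AnomalousDissipation-InterimFluidKinetic"]
def ZerothLawTimePeriodicStmt : Prop :=
  ∀ (h : ZerothLaw), ZerothLawTimePeriodic

end Summit.AnomalousDissipation.AnomalousDissipation.Theses.InterimFluidKinetic
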